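import Summits.ResolutionOfSingularities.ResolutionOfSingularities.Theorems.EquisingularLiftEquisingularLiftNatPointStep
import Summits.ResolutionOfSingularities.ResolutionOfSingularities.Theorems.EquisingularLiftEquisingularLiftCentreBlowupSmooth
import HarnessLib

/-!
# [OURS · L1 W4.5(b) · EL♮] THE NOSE STEP: blowing up an `O`-SMOOTH centre of an `O`-smooth stage, mirrored on an EXACT
# downstairs blow-up (brick 1 of res-L1-w45b-lead-2's TARGET (5) «T-NOSE-THEN-POINTS», STATUS 2026-08-27T07:04:41Z)

Crux `EquisingularLiftNat` = stmt-ResolutionOfSingularities-20038 (route EquisingularLift), line `sections`, registered stub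
`stub_elnat_three_nonisolated`; helper file `--supports … --as helper` by res-type-051 (FREE NAMED-RESERVE volunteer, res-D-plan-1
ROUTING #14 (d), TAKING 2026-08-27T07:23:26Z). HONEST FRAMING: OURS (cell res-hironaka, slot W4.5(b)); NOT a statement of any
manuscript; scheme-theoretic plumbing for a CONDITIONAL rung (the nose centre and the exact downstairs step are explicit binders,
discharged nowhere in this file). AI-written, weaker than expert review. No `sorry`; standard axioms.

THE DEVICE. For a curve `Σ ⊆ Sing H` of an integral surface `H ⊂ ℙ³_k` the first admissible horizontal E1 step of EL♮ is the
«nose»: the blow-up of `ℙ³_O` along a regular `O`-flat centre `C` whose special fibre is `Σ`. When `C → Spec O` is SMOOTH (the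
case of R1/R2: `Σ` linear; ACM / complete-intersection curves: lift the equations), the blown-up ambient stays smooth over `O`
(`smooth_of_isBlowup_smoothCentre`, `goodAt_of_isBlowup_regularCentre`, p461630 lineage), so the POINT steps of T-ISO-0 /
T-ISO-0-REL (Hensel sections through non-regular closed points, res-D-pv-029 p505885 / res-type-022 p509452) remain available
afterwards. This file is the one-step transport in the currency of `pointStep` (p505032), for an arbitrary `O`-smooth centre instead
of a section, with the downstairs blow-up EMBEDDED (`F₁ ⊇ T₁`, centre `D`, strict transform `closure υ⁻¹(T₁ ∖ V(D))`) — the currency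
the PtChain hypothesis of T-ISO-0(-REL) consumes; the INTRINSIC twin (downstairs `Γ` abstract) is res-D-pv-037's `exactShadowStep`
(…NatExactShadow.lean, p509671), which this file neither imports nor re-declares.

* `exists_iso_reducedStrictTransform_exactStep` — EXACT-STEP TRANSPORT (embedded): `υ : F₂ → F₁` a blow-up along `D`, `τ : X″ → X′`
  a blow-up along `C`, `T ⊆ F₁` and `S′ ⊆ X′` closed irreducible, `S′ ⊄ V(C)`, and `e : V(T)_red ≅ V(S′)_red` EXACT
  (`D · 𝒪_{V(T)} =` the `e`-transport of `C · 𝒪_{V(S′)}`) ⇒ `T ⊄ V(D)` and the two reduced strict transforms are isomorphic over `e`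
  (both are blow-ups along corresponding ideal sheaves: DL `exists_isBlowup_reducedStrictTransform` p167331 = Stacks 080E, then
  `IsBlowup.comp_iso` / `IsBlowup.unique`).
* `noseStep` — THE STEP. Setting of `pointStep`: a DVR `O`, `q : P → Spec O` smooth proper, `Y ⊆ P` closed irreducible in the
  special fibre, a stage predicate `Ch` implying `Split.Chain`, closed under horizontal E1 steps and (new, discharged at level 0 by
  p500485) implying irreducibility of the special fibre. UPSTAIRS a `Ch`-stage `(X′, σ′, S′)` with `X′ → Spec O` SMOOTH; a centre
  `C` with `V(C) → Spec O` SMOOTH, `σ′(V(C))` off the generic point of `Y`, special-fibre points of `V(C)` inside `S′`; a blow-up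
  `τ : X″ → X′` along `C`. DOWNSTAIRS `F₁` locally Noetherian, `T₁ ⊆ F₁` closed irreducible, `υ : F₂ → F₁` a blow-up along `D`,
  `e : V(closure T₁)_red ≅ V(closure S′)_red` exact for `(D, C)`. OUTPUT: `Ch` at `(X″, τ ≫ σ′, closure τ⁻¹(S′ ∖ V(C)))`, irreducible
  special fibre, good reduction (`GoodAt`) at EVERY point of `X″`, `F₂` locally Noetherian, `T₁ ⊄ V(D)`, the downstairs strict
  transform irreducible and `V(closure ·)_red`-isomorphic to the upstairs one, and — for `O` of characteristic `0` with algebraically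
  closed residue field — `X″ → Spec O` again SMOOTH (so nose steps iterate).

What it does NOT cover: non-smooth (e.g. ramified multisection) centres — there `GoodAt` does not propagate and the sibling device
files apply. References: …NatPointStep.lean (p505032), …NatPointStepTransport.lean (p504357), …CentreBlowupSmooth.lean /
…CentreBlowupGoodAt.lean (p461630 lineage), …ReducedStrictTransformBlowup.lean (p167331); Q. Liu, *Algebraic Geometry and
Arithmetic Curves*, OUP 2002, Thm. 8.1.19, §8.1; The Stacks Project, Tags 080E, 0805; Görtz–Wedhorn I (13.19); res-L1-w45b-lead-2
STATUS 2026-08-27T07:04:41Z TARGETS (4)(5), L/w45b/CHAIN.md v7.2.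
-/

set_option linter.dupNamespace false -- mandated namespace `Summit.<Summit>.<Problem>` of this single-conjunct summit
set_option linter.overlappingInstances false -- signatures carry `[IsDomain O] [IsDiscreteValuationRing O]`

noncomputable section

open CategoryTheory CategoryTheory.Limits AlgebraicGeometry TopologicalSpace Topology
open Literature.AlgebraicGeometry.Resolution
open AlgebraicGeometry.Scheme.IdealSheafData
open Summit.ResolutionOfSingularities.ResolutionOfSingularities.Theses.EquisingularLift.Split
open Summit.ResolutionOfSingularities.ResolutionOfSingularities.Cruxes.EquisingularLift.StrataSplit

namespace Summit.ResolutionOfSingularities.ResolutionOfSingularities.Cruxes.EquisingularLiftNat.Sections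

/-! ## Exact-step transport: blow-ups along corresponding traces have isomorphic reduced strict transforms -/

/-- **EXACT-STEP TRANSPORT.** Downstairs: `F₁` locally Noetherian, `T ⊆ F₁` closed irreducible, `υ : F₂ → F₁` a blow-up along
an ideal sheaf `D` with `F₂` locally Noetherian. Upstairs: `X'` locally Noetherian, `S' ⊆ X'` closed irreducible with `S' ⊄ V(C)`,
`τ : X'' → X'` a blow-up along `C` with `X''` locally Noetherian. If `e : V(T)_red ≅ V(S')_red` is EXACT for `(D, C)` — the trace
`D · 𝒪_{V(T)_red}` is the transport along `e` of the trace `C · 𝒪_{V(S')_red}` — then the two reduced strict transforms are blow-ups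
of isomorphic schemes along corresponding ideal sheaves (Stacks 080E), hence ISOMORPHIC over `e` (uniqueness of blow-ups); in
particular `T ⊄ V(D)`. [cite: StacksProject, Tag 080E (1); GortzWedhorn2020, (13.19) p. 413] -/
theorem exists_iso_reducedStrictTransform_exactStep
    (F₁ F₂ : Scheme.{0}) [IsLocallyNoetherian F₁] [IsLocallyNoetherian F₂] (T : Set F₁) (hT : IsClosed T)
    (hTirr : IsIrreducible T) (D : F₁.IdealSheafData) (υ : F₂ ⟶ F₁) (hυ : IsBlowup υ D)
    (X' X'' : Scheme.{0}) [IsLocallyNoetherian X'] [IsLocallyNoetherian X''] (S' : Set X') (hS' : IsClosed S')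
    (hirr : IsIrreducible S') (C : X'.IdealSheafData) (τ : X'' ⟶ X') (hτ : IsBlowup τ C)
    (hSC : ¬ S' ⊆ (C.support : Set X'))
    (e : (vanishingIdeal (⟨T, hT⟩ : Closeds F₁)).subscheme ≅ (vanishingIdeal (⟨S', hS'⟩ : Closeds X')).subscheme)
    (hexact : D.comap (vanishingIdeal (⟨T, hT⟩ : Closeds F₁)).subschemeι =
      (C.comap (vanishingIdeal (⟨S', hS'⟩ : Closeds X')).subschemeι).comap e.hom) :
    ¬ T ⊆ (D.support : Set F₁) ∧
    ∃ (ρD : (vanishingIdeal (⟨closure (υ ⁻¹' (T \ (D.support : Set F₁))), isClosed_closure⟩ : Closeds F₂)).subscheme ⟶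
        (vanishingIdeal (⟨T, hT⟩ : Closeds F₁)).subscheme)
      (ρC : (vanishingIdeal (⟨closure (τ ⁻¹' (S' \ (C.support : Set X'))), isClosed_closure⟩ : Closeds X'')).subscheme ⟶
        (vanishingIdeal (⟨S', hS'⟩ : Closeds X')).subscheme)
      (e₂ : (vanishingIdeal (⟨closure (υ ⁻¹' (T \ (D.support : Set F₁))), isClosed_closure⟩ : Closeds F₂)).subscheme ≅
        (vanishingIdeal (⟨closure (τ ⁻¹' (S' \ (C.support : Set X'))), isClosed_closure⟩ : Closeds X'')).subscheme),
      ρD ≫ (vanishingIdeal (⟨T, hT⟩ : Closeds F₁)).subschemeι =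
        (vanishingIdeal (⟨closure (υ ⁻¹' (T \ (D.support : Set F₁))), isClosed_closure⟩ : Closeds F₂)).subschemeι ≫ υ ∧
      ρC ≫ (vanishingIdeal (⟨S', hS'⟩ : Closeds X')).subschemeι =
        (vanishingIdeal (⟨closure (τ ⁻¹' (S' \ (C.support : Set X'))), isClosed_closure⟩ : Closeds X'')).subschemeι ≫ τ ∧
      e₂.hom ≫ ρC = ρD ≫ e.hom := by
  haveI : IsProper υ := hυ.isProper
  haveI : IsProper τ := hτ.isProper
  set ιT := (vanishingIdeal (⟨T, hT⟩ : Closeds F₁)).subschemeι with hιT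
  set ιS := (vanishingIdeal (⟨S', hS'⟩ : Closeds X')).subschemeι with hιS
  have hrangeT : Set.range ιT = T := by
    rw [hιT, range_subschemeι, coe_support_vanishingIdeal]; rfl
  have hrangeS : Set.range ιS = S' := by
    rw [hιS, range_subschemeι, coe_support_vanishingIdeal]; rfl
  -- `T ⊄ V(D)`: otherwise the trace of `D` is everything, hence so is the trace of `C`, and `S' ⊆ V(C)`
  have hTD : ¬ T ⊆ (D.support : Set F₁) := by
    intro hsub
    apply hSC
    intro y hy
    obtain ⟨z, rfl⟩ : y ∈ Set.range ιS := by rw [hrangeS]; exact hy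
    obtain ⟨w, rfl⟩ := e.hom.surjective z
    have hw : w ∈ ((D.comap ιT).support : Set _) := by
      rw [support_comap]
      change ιT w ∈ (D.support : Set F₁)
      exact hsub ((Set.ext_iff.mp hrangeT _).mp (Set.mem_range_self w))
    rw [hexact, support_comap, support_comap] at hw
    exact hw
  obtain ⟨ρD, hρDι, -, hρD⟩ := exists_isBlowup_reducedStrictTransform F₁ F₂ υ D hυ T hT hTirr hTD
  obtain ⟨ρC, hρCι, -, hρC⟩ := exists_isBlowup_reducedStrictTransform X' X'' τ C hτ S' hS' hirr hSC
  rw [hexact] at hρD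
  have h := hρD.comp_iso e
  rw [← Scheme.IdealSheafData.comap_comp, e.inv_hom_id, Scheme.IdealSheafData.comap_id] at h
  obtain ⟨e₂, he₂, -⟩ := h.unique hρC
  exact ⟨hTD, ρD, ρC, e₂, hρDι, hρCι, he₂⟩


/-! ## The nose step at a general `O`-smooth stage -/

/-- **THE NOSE STEP** (module docstring for the reading). In the setting of `pointStep` with a stage predicate `Ch` that also
yields irreducible special fibres: an UPSTAIRS `Ch`-stage `(X′, σ′, S′)` SMOOTH over `O`, a centre `C` with `V(C) → Spec O` SMOOTH,
off the generic point of `Y` and with special-fibre points inside `S′`, a blow-up `τ : X″ → X′` along `C`; DOWNSTAIRS a blow-up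
`υ : F₂ → F₁` along `D` and an EXACT identification `e : V(closure T₁)_red ≅ V(closure S′)_red`. Then the new stage
`(X″, τ ≫ σ′, closure τ⁻¹(S′ ∖ V(C)))` has `Ch`, irreducible special fibre and good reduction at every point; `F₂` is locally
Noetherian, `T₁ ⊄ V(D)`, the downstairs strict transform is irreducible and its reduced structure is isomorphic to the upstairs one;
and `X″ → Spec O` is smooth if `O` has characteristic `0` and algebraically closed residue field.
[folklore; Liu 2002 Thm 8.1.19; Stacks 080E, 0805] -/
theorem noseStep (O : Type) [CommRing O] [IsDomain O] [IsDiscreteValuationRing O]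
    (P : Scheme.{0}) (q : P ⟶ Spec (.of O)) (Y : Closeds P)
    (Ch : ∀ X' : Scheme.{0}, (X' ⟶ P) → Set X' → Prop)
    (hChain : ∀ (X' : Scheme.{0}) (σ : X' ⟶ P) (S : Set X'), Ch X' σ S → Chain P (Y : Set P) X' σ S)
    (hStep : ∀ (X' X'' : Scheme.{0}) (σ' : X' ⟶ P) (S' : Set X') (C : X'.IdealSheafData) (τ : X'' ⟶ X'),
      Ch X' σ' S' → IsBlowup τ C → Scheme.IsRegular C.subscheme → Flat (C.subschemeι ≫ σ' ≫ q) →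
      σ' '' (C.support : Set X') ⊆ {x : P | ¬ IsGenericPoint x (Y : Set P)} →
      (C.support : Set X') ∩ (σ' ≫ q) ⁻¹' {IsLocalRing.closedPoint O} ⊆ S' →
      Ch X'' (τ ≫ σ') (closure (τ ⁻¹' (S' \ (C.support : Set X')))))
    (hChIrr : ∀ (X' : Scheme.{0}) (σ : X' ⟶ P) (S : Set X'), Ch X' σ S →
      IsIrreducible ((σ ≫ q) ⁻¹' {IsLocalRing.closedPoint O}))
    (hq : Smooth q) (hqp : IsProper q)
    (hY : (Y : Set P) ⊆ q ⁻¹' {IsLocalRing.closedPoint O}) (hYirr : IsIrreducible (Y : Set P))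
    -- the upstairs stage, SMOOTH over `O`
    (X' : Scheme.{0}) (σ' : X' ⟶ P) (S' : Set X') (hCh : Ch X' σ' S') (hXsm : Smooth (σ' ≫ q))
    -- the centre: smooth over `O`, off the generic point of `Y`, special-fibre points inside `S'`; a blow-up along it
    (C : X'.IdealSheafData) (hCsm : Smooth (C.subschemeι ≫ σ' ≫ q))
    (hTY : σ' '' (C.support : Set X') ⊆ {x : P | ¬ IsGenericPoint x (Y : Set P)})
    (hE1 : (C.support : Set X') ∩ (σ' ≫ q) ⁻¹' {IsLocalRing.closedPoint O} ⊆ S')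
    (X'' : Scheme.{0}) (τ : X'' ⟶ X') (hτ : IsBlowup τ C)
    -- the downstairs stage and step, EXACT for `C` along `e`
    (F₁ F₂ : Scheme.{0}) [IsLocallyNoetherian F₁] (T₁ : Set F₁) (hT₁cl : IsClosed T₁) (hT₁irr : IsIrreducible T₁)
    (D : F₁.IdealSheafData) (υ : F₂ ⟶ F₁) (hυ : IsBlowup υ D)
    (e : (vanishingIdeal (⟨closure T₁, isClosed_closure⟩ : Closeds F₁)).subscheme ≅
      (vanishingIdeal (⟨closure S', isClosed_closure⟩ : Closeds X')).subscheme)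
    (hexact : D.comap (vanishingIdeal (⟨closure T₁, isClosed_closure⟩ : Closeds F₁)).subschemeι =
      (C.comap (vanishingIdeal (⟨closure S', isClosed_closure⟩ : Closeds X')).subschemeι).comap e.hom) :
    Ch X'' (τ ≫ σ') (closure (τ ⁻¹' (S' \ (C.support : Set X')))) ∧
    IsIrreducible (((τ ≫ σ') ≫ q) ⁻¹' {IsLocalRing.closedPoint O}) ∧
    (∀ w : X'', GoodAt ((τ ≫ σ') ≫ q) w) ∧
    IsLocallyNoetherian F₂ ∧ ¬ T₁ ⊆ (D.support : Set F₁) ∧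
    IsIrreducible (closure (υ ⁻¹' (T₁ \ (D.support : Set F₁)))) ∧
    Nonempty ((vanishingIdeal (⟨closure (closure (υ ⁻¹' (T₁ \ (D.support : Set F₁)))), isClosed_closure⟩ :
        Closeds F₂)).subscheme ≅
      (vanishingIdeal (⟨closure (closure (τ ⁻¹' (S' \ (C.support : Set X')))), isClosed_closure⟩ : Closeds X'')).subscheme) ∧
    (∀ [CharZero O] [IsAlgClosed (IsLocalRing.ResidueField O)], Smooth ((τ ≫ σ') ≫ q)) := by
  classical
  have hch : Chain P (Y : Set P) X' σ' S' := hChain _ _ _ hCh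
  -- ambient facts
  haveI := hq
  haveI := hqp
  have hPnoeth : IsLocallyNoetherian P := LocallyOfFiniteType.isLocallyNoetherian q
  have hPreg : Scheme.IsRegular P := fun y => (stub_goodAtOfSmooth O P q hq y).1
  obtain ⟨hnoeth', hreg', hσ'⟩ := chain_isRegular P (Y : Set P) X' σ' S' hch hPnoeth hPreg
  haveI := hnoeth'
  haveI := hσ'
  set r' : X' ⟶ Spec (.of O) := σ' ≫ q with hr'
  haveI : IsProper r' := inferInstance
  haveI hXsm' : Smooth r' := hXsm
  set s₀ := IsLocalRing.closedPoint O with hs₀def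
  -- `S'` is closed irreducible inside the special fibre; the point `ξ'` over the generic point `ξ` of `Y` is off the centre
  obtain ⟨ξ, hξ⟩ : ∃ ξ : P, IsGenericPoint ξ (Y : Set P) := QuasiSober.sober hYirr Y.isClosed
  obtain ⟨ξ', hfib', hS'⟩ := Chain.fibre hch hξ
  have hS'cl : IsClosed S' := by rw [hS']; exact isClosed_closure
  have hclS' : closure S' = S' := hS'cl.closure_eq
  have hS'irr : IsIrreducible (closure S') := by
    rw [hS', closure_closure]; exact isIrreducible_singleton.closure
  have hS'sub : closure S' ⊆ r' ⁻¹' {s₀} := closure_subset_preimage_of_chain q hYirr Y.isClosed hY hch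
  have hσξ' : σ' ξ' = ξ := by
    have : ξ' ∈ σ' ⁻¹' {ξ} := by rw [hfib']; rfl
    simpa using this
  have hξ'mem : ξ' ∈ closure S' := by rw [hS', closure_closure]; exact subset_closure rfl
  have hξ'C : ξ' ∉ (C.support : Set X') := fun h' => hTY ⟨ξ', h', hσξ'⟩ hξ
  have hnotsub : ¬ closure S' ⊆ (C.support : Set X') := fun h => hξ'C (h hξ'mem)
  -- the special fibre of the stage is irreducible; the stage is integral
  have hirr : IsIrreducible (r' ⁻¹' {s₀}) := hChIrr _ _ _ hCh
  have hr'ξ' : r' ξ' = s₀ := hS'sub hξ'mem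
  obtain ⟨hint', -, -⟩ := isIntegral_and_flat_of_goodAt O X' r' hnoeth' hreg' hirr
    ⟨ξ', hr'ξ', stub_goodAtOfSmooth O X' r' hXsm ξ'⟩
  haveI := hint'
  -- the centre is regular, `O`-flat, with regular special fibre (it is smooth over `O`)
  set ικ := Spec.map (CommRingCat.ofHom (IsLocalRing.residue O)) with hικ
  haveI hCsm' : Smooth (C.subschemeι ≫ r') := hCsm
  haveI : IsRegularRing (CommRingCat.of O) := inferInstanceAs (IsRegularRing O)
  have hCreg : Scheme.IsRegular C.subscheme :=
    Scheme.IsRegular.of_smooth (C.subschemeι ≫ r') (Scheme.isRegular_Spec (.of O))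
  have hCflat : Flat (C.subschemeι ≫ r') := inferInstance
  have hCflat' : Flat (C.subschemeι ≫ σ' ≫ q) := hCflat
  have hreg3 : Scheme.IsRegular ↑(pullback (C.subschemeι ≫ r') ικ) := fun z =>
    isRegularLocalRing_stalk_of_smooth_of_field (pullback.snd (C.subschemeι ≫ r') ικ) z
  let eκ : ↑(C.comap (pullback.fst r' ικ)).subscheme ⟶ ↑(pullback (C.subschemeι ≫ r') ικ) :=
    (C.comapIso (pullback.fst r' ικ)).hom ≫ (pullbackSymmetry _ _).hom ≫
      (pullbackRightPullbackFstIso r' ικ C.subschemeι).hom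
  have hCκ : Scheme.IsRegular (C.comap (pullback.fst r' ικ)).subscheme := Scheme.IsRegular.of_isOpenImmersion eκ hreg3
  -- the blow-up
  haveI : IsProper τ := hτ.isProper
  have hnoeth'' : IsLocallyNoetherian X'' := LocallyOfFiniteType.isLocallyNoetherian τ
  haveI := hnoeth''
  -- (1) the new stage is in `Ch`, (2) its special fibre is irreducible
  have hCh'' : Ch X'' (τ ≫ σ') (closure (τ ⁻¹' (S' \ (C.support : Set X')))) :=
    hStep X' X'' σ' S' C τ hCh hτ hCreg hCflat' hTY hE1
  have hirr'' : IsIrreducible (((τ ≫ σ') ≫ q) ⁻¹' {s₀}) := hChIrr _ _ _ hCh''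
  -- (3) good reduction EVERYWHERE on `X''`
  have hgood'' : ∀ w : X'', GoodAt ((τ ≫ σ') ≫ q) w := by
    intro w
    rw [Category.assoc]
    exact goodAt_of_isBlowup_regularCentre O X' X'' r' C hCreg hCflat hCκ τ hτ w
  -- DOWNSTAIRS bookkeeping
  haveI : IsProper υ := hυ.isProper
  have hnoethF₂ : IsLocallyNoetherian F₂ := LocallyOfFiniteType.isLocallyNoetherian υ
  haveI := hnoethF₂
  have hclT₁ : closure T₁ = T₁ := hT₁cl.closure_eq
  have hT₁irr' : IsIrreducible (closure T₁) := by rw [hclT₁]; exact hT₁irr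
  -- the TRANSPORT
  obtain ⟨hTD, ρD, ρC, e₂, -, -, -⟩ := exists_iso_reducedStrictTransform_exactStep F₁ F₂ (closure T₁) isClosed_closure
    hT₁irr' D υ hυ X' X'' (closure S') isClosed_closure hS'irr C τ hτ hnotsub e hexact
  have hTD' : ¬ T₁ ⊆ (D.support : Set F₁) := by rwa [hclT₁] at hTD
  -- rewrite the two strict-transform sets into the forms of the conclusion
  have hDn : (⟨closure (υ ⁻¹' (closure T₁ \ (D.support : Set F₁))), isClosed_closure⟩ : Closeds F₂) =
      ⟨closure (closure (υ ⁻¹' (T₁ \ (D.support : Set F₁)))), isClosed_closure⟩ := by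
    apply Closeds.ext
    change closure _ = closure (closure _)
    rw [closure_closure, hclT₁]
  have hUp : (⟨closure (τ ⁻¹' (closure S' \ (C.support : Set X'))), isClosed_closure⟩ : Closeds X'') =
      ⟨closure (closure (τ ⁻¹' (S' \ (C.support : Set X')))), isClosed_closure⟩ := by
    apply Closeds.ext
    change closure _ = closure (closure _)
    rw [closure_closure, hclS']
  rw [hDn, hUp] at e₂
  -- irreducibility of the downstairs strict transform, through `e₂` and the upstairs generic point
  have hch'' : Chain P (Y : Set P) X'' (τ ≫ σ') (closure (τ ⁻¹' (S' \ (C.support : Set X')))) := hChain _ _ _ hCh''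
  obtain ⟨ξ'', -, hS''⟩ := Chain.fibre hch'' hξ
  have hS''irr : IsIrreducible (closure (closure (τ ⁻¹' (S' \ (C.support : Set X'))))) := by
    rw [hS'', closure_closure]; exact isIrreducible_singleton.closure
  haveI hint'' : IsIntegral (vanishingIdeal (⟨closure (closure (τ ⁻¹' (S' \ (C.support : Set X')))), isClosed_closure⟩ :
      Closeds X'')).subscheme := ComponentGluing.isIntegral_subscheme_vanishingIdeal _ hS''irr
  haveI hintD : IsIntegral (vanishingIdeal (⟨closure (closure (υ ⁻¹' (T₁ \ (D.support : Set F₁)))), isClosed_closure⟩ :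
      Closeds F₂)).subscheme := IsIntegral.of_isIso e₂.inv
  have hTirr₂ : IsIrreducible (closure (υ ⁻¹' (T₁ \ (D.support : Set F₁)))) := by
    have hr : Set.range (vanishingIdeal (⟨closure (closure (υ ⁻¹' (T₁ \ (D.support : Set F₁)))), isClosed_closure⟩ :
        Closeds F₂)).subschemeι = closure (υ ⁻¹' (T₁ \ (D.support : Set F₁))) := by
      rw [range_subschemeι, coe_support_vanishingIdeal]
      change closure (closure _) = closure _
      rw [closure_closure]
    rw [← hr, ← Set.image_univ]
    exact (IrreducibleSpace.isIrreducible_univ _).image _ (Scheme.Hom.continuous _).continuousOn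
  -- the new stage is again SMOOTH over `O` (characteristic-0 DVR with algebraically closed residue field)
  have hCne : C ≠ ⊥ := by
    intro h
    apply hξ'C
    rw [h, Scheme.IdealSheafData.support_bot]
    trivial
  have hsm'' : ∀ [CharZero O] [IsAlgClosed (IsLocalRing.ResidueField O)], Smooth ((τ ≫ σ') ≫ q) := by
    intro _ _
    rw [Category.assoc]
    exact smooth_of_isBlowup_smoothCentre O X' X'' r' C hCne hCsm' τ hτ
  exact ⟨hCh'', hirr'', hgood'', hnoethF₂, hTD', hTirr₂, ⟨e₂⟩, hsm''⟩

end Summit.ResolutionOfSingularities.ResolutionOfSingularities.Cruxes.EquisingularLiftNat.Sections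

end
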